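import Mathlib
import HarnessLib
import Summits.ResolutionOfSingularities.ResolutionOfSingularities.Theorems.WildQuotientsWildQuotientResolutionTerminalBlowupSpec
import Summits.ResolutionOfSingularities.ResolutionOfSingularities.Theorems.WildQuotientsWildQuotientResolutionStubStableAffineCoverBlowup
import Summits.ResolutionOfSingularities.ResolutionOfSingularities.Theorems.WildQuotientsGaloisQuotientStableCover
import Summits.ResolutionOfSingularities.ResolutionOfSingularities.Theorems.WildQuotientsWildQuotientResolutionTwoBlocksChartAlgebra

/-!
# The terminal model of `𝔸⁴/(J₂ ⊕ J₂)`: one blow-up of `V(x₀, x₂)` (S4-scheme of programme T)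
(crux stmt-ResolutionOfSingularities-15640 `WildQuotients.WildQuotientResolution`, line `Sketch`;
chain w45c `L/w45c/CHAIN.md` v2 §4, stub S4-scheme `TwoBlocks.twoBlocks_terminalModel`)

[OURS · L1 W4.5c; NOT a statement of the manuscript.] For the two-Jordan-block automorphism
`σ = J₂ ⊕ J₂` of `k[x₀, …, x₃]` (`σ x₁ = x₁ + x₀`, `σ x₃ = x₃ + x₂`, `x₀, x₂` fixed; given
ABSTRACTLY by `h0`–`h3`), any field `k`, the cyclic group `G = ⟨σ⟩` (assumed finite — in
characteristic `p` it has order `p`, `TwoBlocks.stub_twoBlocks_order`, p466559) acting on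
`𝔸⁴ = Spec k[x]` by `ρ g = Spec (g⁻¹)` (`AffineQuotient.exists_specAction`, p466417), and ANY
blow-up `π : V → 𝔸⁴` of the `σ`-fixed plane `V(x₀, x₂)` (`IsBlowup π` of the ideal sheaf of
`(x₀, x₂)`; e.g. `affineBlowup.π`, `affineBlowup.isBlowup`), **`twoBlocks_liftAction_terminal`**
provides the lifted action `ρV : G →* Aut V` (`IsBlowup.liftAction`) with the three conjuncts of
the Király–Lütkebohmert terminal state consumed by `CyclicTransfer.cyclicDivisorialTransfer` /
`CyclicDivisorialModelsLE`: `π` is equivariant (`liftAction_hom_comp`); every point of `V` has a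
`G`-stable affine neighbourhood (`StableAffineCoverBlowup.stub_stableAffineCoverBlowup`, p151564,
over `q : 𝔸⁴ → Spec k`); and at every point fixed by some `ρV g` the augmentation ideal of the
stalk action is principal — for `g` acting trivially the lift is the identity
(`IsBlowup.eq_id_of_comp_eq`) and the ideal is `0`, otherwise `g x₁ = x₁ + c x₀`,
`g x₃ = x₃ + c x₂` with `c ≠ 0` (`zpowers_shape`), so `(x₀, x₂)` is the augmentation ideal of `g`
with `g`-invariant generators (`sub_mem_span_of_shape`) and
`TerminalBlowup.isPrincipal_stalkAug_liftAction_spec` (p469646) applies. Regularity, integrality,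
properness and birationality of `V = Bl_{(x₀,x₂)} 𝔸⁴` are S3 of the chain (separate file); with
them and the quotient data this is the input of `cyclicDivisorialTransfer_of_card` for the target
`twoJordanBlocksFourfold_hasResolution`.
-/

-- single-problem summit: the doubled namespace component `ResolutionOfSingularities` is forced
set_option linter.dupNamespace false

noncomputable section

open CategoryTheory AlgebraicGeometry TopologicalSpace MvPolynomial
open Literature.AlgebraicGeometry.Resolution

namespace Summit.ResolutionOfSingularities.ResolutionOfSingularities.Theorems.WildQuotientResolution.TwoBlocks

/-- **The elements of `⟨σ⟩` are two-block transvections**: every `g ∈ zpowers σ` satisfies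
`g x₀ = x₀`, `g x₁ = x₁ + c x₀`, `g x₂ = x₂`, `g x₃ = x₃ + c x₂` for some `c ∈ k` (closure
induction: `c` adds under products, negates under inverses; `c = 1` for `σ`). [folklore] -/
theorem zpowers_shape (k : Type) [Field k]
    (σ : MvPolynomial (Fin 4) k ≃ₐ[k] MvPolynomial (Fin 4) k)
    (h0 : σ (X 0) = X 0) (h1 : σ (X 1) = X 1 + X 0)
    (h2 : σ (X 2) = X 2) (h3 : σ (X 3) = X 3 + X 2)
    (g : MvPolynomial (Fin 4) k ≃ₐ[k] MvPolynomial (Fin 4) k) (hg : g ∈ Subgroup.zpowers σ) :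
    ∃ c : k, g (X 0) = X 0 ∧ g (X 1) = X 1 + C c * X 0 ∧ g (X 2) = X 2 ∧
      g (X 3) = X 3 + C c * X 2 := by
  have hC : ∀ (e : MvPolynomial (Fin 4) k ≃ₐ[k] MvPolynomial (Fin 4) k) (c : k), e (C c) = C c :=
    fun e c => e.commutes c
  rw [Subgroup.zpowers_eq_closure] at hg
  induction hg using Subgroup.closure_induction with
  | mem x hx =>
    rw [Set.mem_singleton_iff] at hx
    subst hx
    exact ⟨1, h0, by rw [h1, C_1, one_mul], h2, by rw [h3, C_1, one_mul]⟩
  | one => exact ⟨0, rfl, by simp, rfl, by simp⟩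
  | mul x y _ _ hx hy =>
    obtain ⟨a, ha0, ha1, ha2, ha3⟩ := hx
    obtain ⟨b, hb0, hb1, hb2, hb3⟩ := hy
    refine ⟨a + b, ?_, ?_, ?_, ?_⟩
    · rw [AlgEquiv.mul_apply, hb0, ha0]
    · rw [AlgEquiv.mul_apply, hb1, map_add, map_mul, hC, ha1, ha0, C_add]
      ring
    · rw [AlgEquiv.mul_apply, hb2, ha2]
    · rw [AlgEquiv.mul_apply, hb3, map_add, map_mul, hC, ha3, ha2, C_add]
      ring
  | inv x _ hx =>
    obtain ⟨a, ha0, ha1, ha2, ha3⟩ := hx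
    have hi0 : x⁻¹ (X 0) = X 0 := by
      rw [AlgEquiv.aut_inv]
      conv_lhs => rw [← ha0]
      exact x.symm_apply_apply _
    have hi2 : x⁻¹ (X 2) = X 2 := by
      rw [AlgEquiv.aut_inv]
      conv_lhs => rw [← ha2]
      exact x.symm_apply_apply _
    refine ⟨-a, hi0, ?_, hi2, ?_⟩
    · have h : x⁻¹ (x (X 1)) = x⁻¹ (X 1 + C a * X 0) := by rw [ha1]
      rw [map_add, map_mul, hC, hi0, AlgEquiv.aut_inv, x.symm_apply_apply] at h
      rw [AlgEquiv.aut_inv, C_neg]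
      linear_combination -h
    · have h : x⁻¹ (x (X 3)) = x⁻¹ (X 3 + C a * X 2) := by rw [ha3]
      rw [map_add, map_mul, hC, hi2, AlgEquiv.aut_inv, x.symm_apply_apply] at h
      rw [AlgEquiv.aut_inv, C_neg]
      linear_combination -h

/-- **`g f ≡ f (mod (x₀, x₂))`** for a `k`-algebra automorphism `g` of two-block shape
(`g x₁ = x₁ + c x₀`, `g x₃ = x₃ + c x₂`, `x₀, x₂` fixed): true on the variables and preserved
under sums and products (`g (f h) - f h = (g f - f) g h + f (g h - h)`). [folklore] -/
theorem sub_mem_span_of_shape (k : Type) [Field k]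
    (g : MvPolynomial (Fin 4) k ≃ₐ[k] MvPolynomial (Fin 4) k) (c : k)
    (h0 : g (X 0) = X 0) (h1 : g (X 1) = X 1 + C c * X 0)
    (h2 : g (X 2) = X 2) (h3 : g (X 3) = X 3 + C c * X 2) (f : MvPolynomial (Fin 4) k) :
    g f - f ∈ Ideal.span ({X 0, X 2} : Set (MvPolynomial (Fin 4) k)) := by
  have hX : ∀ i : Fin 4, g (X i) - X i ∈ Ideal.span ({X 0, X 2} : Set (MvPolynomial (Fin 4) k)) := by
    intro i
    match i with
    | 0 => rw [h0, sub_self]; exact Ideal.zero_mem _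
    | 1 =>
      rw [h1, add_sub_cancel_left]
      exact Ideal.mul_mem_left _ _ (Ideal.subset_span (Set.mem_insert _ _))
    | 2 => rw [h2, sub_self]; exact Ideal.zero_mem _
    | 3 =>
      rw [h3, add_sub_cancel_left]
      exact Ideal.mul_mem_left _ _ (Ideal.subset_span (Set.mem_insert_of_mem _ rfl))
  induction f using MvPolynomial.induction_on with
  | C a =>
    have hc : g (C a) = C a := g.commutes a
    rw [hc, sub_self]
    exact Ideal.zero_mem _
  | add f₁ f₂ hf₁ hf₂ =>
    have : g (f₁ + f₂) - (f₁ + f₂) = (g f₁ - f₁) + (g f₂ - f₂) := by rw [map_add]; ring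
    rw [this]
    exact Ideal.add_mem _ hf₁ hf₂
  | mul_X f i hf =>
    have : g (f * X i) - f * X i = (g f - f) * g (X i) + f * (g (X i) - X i) := by
      rw [map_mul]; ring
    rw [this]
    exact Ideal.add_mem _ (Ideal.mul_mem_right _ _ hf) (Ideal.mul_mem_left _ _ (hX i))

/-- **S4-scheme: the lifted action on a blow-up of `V(x₀, x₂) ⊂ 𝔸⁴` is Király–Lütkebohmert
terminal.** Let `σ` be the two-block automorphism of `k[x₀,…,x₃]` (`h0`–`h3`) with `⟨σ⟩`
finite, `ρ : ⟨σ⟩ →* Aut 𝔸⁴` the action `g ↦ Spec (g⁻¹)` (`hρ`, the format of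
`AffineQuotient.exists_specAction`), and `π : V → 𝔸⁴` a blow-up along the ideal sheaf of
`(x₀, x₂)`. Then there is an action `ρV` of `⟨σ⟩` on `V` with: (i) `ρV g ≫ π = π ≫ ρ g`;
(ii) every `v ∈ V` has a `⟨σ⟩`-stable affine open neighbourhood; (iii) for every `g` and every
`v` fixed by `ρV g`, the ideal `⟨(stalkSpecializes ≫ (ρV g)^♯_v) s - s : s ∈ 𝒪_{V,v}⟩` is
principal. (`ρV = IsBlowup.liftAction`, the centre being `⟨σ⟩`-stable
(`TerminalBlowup.idealSheaf_comap_specAction`, `stub_twoBlocks_map_centre`); (ii) is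
`StableAffineCoverBlowup.stub_stableAffineCoverBlowup` over `𝔸⁴ → Spec k`; (iii) is
`TerminalBlowup.isPrincipal_stalkAug_liftAction_spec` with generators `x₀, x₂` when
`g x₁ = x₁ + c x₀`, `c ≠ 0` (`x₀ = c⁻¹ (g x₁ - x₁)`, `x₂ = c⁻¹ (g x₃ - x₃)`), and the zero ideal
when `c = 0`, the lift of the identity being the identity.) [folklore; assembly of landed decls] -/
theorem twoBlocks_liftAction_terminal (k : Type) [Field k]
    (σ : MvPolynomial (Fin 4) k ≃ₐ[k] MvPolynomial (Fin 4) k)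
    (h0 : σ (X 0) = X 0) (h1 : σ (X 1) = X 1 + X 0)
    (h2 : σ (X 2) = X 2) (h3 : σ (X 3) = X 3 + X 2) [Finite (Subgroup.zpowers σ)]
    (ρ : Subgroup.zpowers σ →* Aut (Spec (CommRingCat.of (MvPolynomial (Fin 4) k))))
    (hρ : ∀ g : Subgroup.zpowers σ, (ρ g).hom = Spec.map (CommRingCat.ofHom
      ((MulSemiringAction.toRingEquiv (Subgroup.zpowers σ) (MvPolynomial (Fin 4) k) g⁻¹ :
        MvPolynomial (Fin 4) k ≃+* MvPolynomial (Fin 4) k) :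
          MvPolynomial (Fin 4) k →+* MvPolynomial (Fin 4) k)))
    {V : Scheme.{0}} {π : V ⟶ Spec (CommRingCat.of (MvPolynomial (Fin 4) k))}
    (hπ : IsBlowup π (affineBlowup.idealSheaf
      (Ideal.span {X 0, X 2} : Ideal (MvPolynomial (Fin 4) k)))) :
    ∃ ρV : Subgroup.zpowers σ →* Aut V,
      (∀ g, (ρV g).hom ≫ π = π ≫ (ρ g).hom) ∧
      (∀ v : V, ∃ W : V.Opens, IsAffineOpen W ∧ v ∈ W ∧ ∀ g, (ρV g).hom ⁻¹ᵁ W = W) ∧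
      ∀ (g : Subgroup.zpowers σ) (v : V) (hv : (ρV g).hom.base v = v),
        (Ideal.span (Set.range fun s : V.presheaf.stalk v =>
          (V.presheaf.stalkSpecializes (specializes_of_eq hv) ≫ (ρV g).hom.stalkMap v).hom s -
            s)).IsPrincipal := by
  classical
  have hsmul : ∀ (g : Subgroup.zpowers σ) (b : MvPolynomial (Fin 4) k),
      g • b = (g : MvPolynomial (Fin 4) k ≃ₐ[k] MvPolynomial (Fin 4) k) b := fun g b => rfl
  -- the centre `(x₀, x₂)` is `G`-stable
  have hI : ∀ (g : Subgroup.zpowers σ) (b : MvPolynomial (Fin 4) k),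
      b ∈ (Ideal.span {X 0, X 2} : Ideal (MvPolynomial (Fin 4) k)) →
      g • b ∈ (Ideal.span {X 0, X 2} : Ideal (MvPolynomial (Fin 4) k)) := by
    intro g b hb
    obtain ⟨c, e0, -, e2, -⟩ := zpowers_shape k σ h0 h1 h2 h3 g g.2
    rw [hsmul, ← stub_twoBlocks_map_centre k (g : MvPolynomial (Fin 4) k ≃ₐ[k] _) e0 e2]
    exact Ideal.mem_map_of_mem _ hb
  have hJ : ∀ g : Subgroup.zpowers σ,
      (affineBlowup.idealSheaf (Ideal.span {X 0, X 2} : Ideal (MvPolynomial (Fin 4) k))).comap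
        (ρ g).hom = affineBlowup.idealSheaf (Ideal.span {X 0, X 2}) :=
    fun g => TerminalBlowup.idealSheaf_comap_specAction ρ hρ _ hI g
  refine ⟨hπ.liftAction ρ hJ, fun g => hπ.liftAction_hom_comp ρ hJ g, ?_, ?_⟩
  · -- Mumford's hypothesis: `G`-stable affine neighbourhoods (the landed blow-up stub)
    intro v
    let q : Spec (CommRingCat.of (MvPolynomial (Fin 4) k)) ⟶ Spec (CommRingCat.of k) :=
      Spec.map (CommRingCat.ofHom (algebraMap k (MvPolynomial (Fin 4) k)))
    haveI : IsAffineHom q := isAffineHom_of_isAffine_of_isSeparated q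
    have hρq : ∀ g : Subgroup.zpowers σ, (ρ g).hom ≫ q = q := by
      intro g
      simp only [q, hρ, ← Spec.map_comp, ← CommRingCat.ofHom_comp]
      congr 2
      refine RingHom.ext fun c => ?_
      change (MulSemiringAction.toRingEquiv _ _ g⁻¹) (algebraMap k _ c) = algebraMap k _ c
      rw [MulSemiringAction.toRingEquiv_apply_apply, hsmul]
      exact (↑(g⁻¹) : MvPolynomial (Fin 4) k ≃ₐ[k] MvPolynomial (Fin 4) k).commutes c
    exact StableAffineCoverBlowup.stub_stableAffineCoverBlowup q ρ hρq hπ (hπ.liftAction ρ hJ)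
      (fun g => hπ.liftAction_hom_comp ρ hJ g) v
  · -- the divisorial hypothesis at fixed points
    intro g v hv
    obtain ⟨c, e0, e1, e2, e3⟩ := zpowers_shape k σ h0 h1 h2 h3 g g.2
    by_cases hc : c = 0
    · -- `g` acts trivially: the lift is the identity and the augmentation ideal is zero
      have hgid : ((g : MvPolynomial (Fin 4) k ≃ₐ[k] MvPolynomial (Fin 4) k) :
          MvPolynomial (Fin 4) k →ₐ[k] MvPolynomial (Fin 4) k) = AlgHom.id k _ := by
        refine MvPolynomial.algHom_ext fun i => ?_
        change (g : MvPolynomial (Fin 4) k ≃ₐ[k] MvPolynomial (Fin 4) k) (X i) = X i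
        match i with
        | 0 => exact e0
        | 1 => rw [e1, hc, C_0, zero_mul, add_zero]
        | 2 => exact e2
        | 3 => rw [e3, hc, C_0, zero_mul, add_zero]
      have hg1 : ∀ b : MvPolynomial (Fin 4) k, g • b = b := fun b => by
        rw [hsmul]
        exact DFunLike.congr_fun hgid b
      have hρg : (ρ g).hom = 𝟙 _ := by
        rw [hρ]
        have : ((MulSemiringAction.toRingEquiv (Subgroup.zpowers σ) (MvPolynomial (Fin 4) k) g⁻¹ :
            MvPolynomial (Fin 4) k ≃+* MvPolynomial (Fin 4) k) :
              MvPolynomial (Fin 4) k →+* MvPolynomial (Fin 4) k) = RingHom.id _ := by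
          refine RingHom.ext fun b => ?_
          change (MulSemiringAction.toRingEquiv _ _ g⁻¹) b = b
          rw [MulSemiringAction.toRingEquiv_apply_apply, inv_smul_eq_iff, hg1]
        rw [this, CommRingCat.ofHom_id, Spec.map_id]
      have hlift : (hπ.liftAction ρ hJ g).hom = 𝟙 V :=
        hπ.eq_id_of_comp_eq (by rw [hπ.liftAction_hom_comp, hρg, Category.comp_id])
      have key : ∀ (f : V ⟶ V) (_ : f = 𝟙 V) (hvf : f.base v = v),
          Ideal.span (Set.range fun s : V.presheaf.stalk v =>
            (V.presheaf.stalkSpecializes (specializes_of_eq hvf) ≫ f.stalkMap v).hom s - s) = ⊥ := by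
        intro f hf hvf
        subst hf
        refine Ideal.span_eq_bot.mpr ?_
        rintro _ ⟨s, rfl⟩
        change ((𝟙 V : V ⟶ V).stalkMap v).hom
          ((V.presheaf.stalkSpecializes (specializes_of_eq hvf)).hom s) - s = 0
        erw [Scheme.Hom.stalkMap_id]
        rw [sub_eq_zero]
        exact stalkSpecializes_self_apply V.presheaf v _ s
      rw [key _ hlift hv]
      exact bot_isPrincipal
    · -- `g` non-trivial: the terminal blow-up lemma with generators `x₀, x₂`
      refine TerminalBlowup.isPrincipal_stalkAug_liftAction_spec ρ hρ _ hπ hJ g ![X 0, X 2] ?_ ?_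
        ?_ ?_ v hv
      · rw [Matrix.range_cons, Matrix.range_cons_empty, Set.singleton_union]
      · intro j
        fin_cases j
        · simpa [hsmul] using e0
        · simpa [hsmul] using e2
      · intro b
        rw [hsmul]
        exact sub_mem_span_of_shape k _ c e0 e1 e2 e3 b
      · intro j
        have hX0 : (X 0 : MvPolynomial (Fin 4) k) = C c⁻¹ * (g • X 1 - X 1) := by
          rw [hsmul, e1, add_sub_cancel_left, ← mul_assoc, ← C_mul, inv_mul_cancel₀ hc, C_1,
            one_mul]
        have hX2 : (X 2 : MvPolynomial (Fin 4) k) = C c⁻¹ * (g • X 3 - X 3) := by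
          rw [hsmul, e3, add_sub_cancel_left, ← mul_assoc, ← C_mul, inv_mul_cancel₀ hc, C_1,
            one_mul]
        fin_cases j
        · change (X 0 : MvPolynomial (Fin 4) k) ∈ _
          rw [hX0]
          exact Ideal.mul_mem_left _ _ (Ideal.subset_span ⟨X 1, rfl⟩)
        · change (X 2 : MvPolynomial (Fin 4) k) ∈ _
          rw [hX2]
          exact Ideal.mul_mem_left _ _ (Ideal.subset_span ⟨X 3, rfl⟩)

end Summit.ResolutionOfSingularities.ResolutionOfSingularities.Theorems.WildQuotientResolution.TwoBlocks

end
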